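import Summits.CriticalPhenomena.PercolationContinuityZ3.Theorems.Transplant.SkelConcFaceRun
import Summits.CriticalPhenomena.PercolationContinuityZ3.Theorems.Transplant.SkelConcFaceAcc
import HarnessLib

/-!
# L7 (Z), part (F): the FACE obligation of the CONCRETE GENERIC choice function — `SkelConc.faceHoldsR_concChoice₀` (= `FaceHoldsRFn concChoice₀`,
# unfolded per instance) — hp-8's `Skel.faceOblR_concS_kits` (the (F) residue of the concentric scheme of record over a planar skeleton, kit clauses
# discharged, SkelConcFaceRun) instantiated at stmt-g7's `SkelConc.concChoice₀` through the `AtQ` unpacking (SkelConcParamsAtQ/ParamsFace) and the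
# (F) supply lemmas (SkelConcFaceAcc: `δA_spec_win`, the generic level window, the inner radius WITH THE KIT REACH `L_A := LAc + reachK`,
# `L'_A := ψ(6t) + ψ M + reachK` — lead ruling 2026-08-21T00:04:30Z)

builds on p205010 (kernel theorem, internal audit signed; external expert review pending) — nothing in this file uses p205010.
Status sentence (coordinator 2026-08-20T04:30Z): "θ(p_c) = 0 on ℤ^d, all d ≥ 2 — kernel-verified (Lean 4/Mathlib, standard axioms); internal
adversarial audit SIGNED 2026-08-20 04:29Z; external expert review pending."
Lane `prim-bschramm-*`, seat `prim-bschramm-p3` (gen 6; (F) wrapper fallback per lead g4 00:02:58Z (5)); helper file (`--supports stmt-CriticalPhenomena-4575`).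

Constants fed (the binder list (B) of `Skel.faceOblR_concS_kits`): outer accuracy `κ.δ₂`, inner accuracy `δA := SkelConc.δA Φ κ.K₀ κ.δ₂`, input margin
`am := δmin²`, `Δ' = Δ'ᵢ := Φ.Δ`, level windows `Mj := 8 M₀ + 12`, `Rlev = RlevA := 8 M₀ + 12 + L`, `j₀A := 8 M₀ + 13`, `N = N_A := Conc.Nc`, `k = kkA := Conc.kc`,
scales `Ssc := Conc.Sc`, seed slab `ℓs := M₀ + 1`, `R' := Conc.Rseedc`, `r₀ := Conc.r₀c`, `rs := Conc.rsc`, inner run `s₁ := s`, `R'ᵢ := Conc.R'c`,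
`ℓ₀ := M₀ + 1`, `ℓ1 := M₀ + s + 2 R'c + 1`, `ℓ₁A := 6 t`, `nmax := 12 K`, `L_A := Conc.LAc + Conc.reachK`, `L'_A := ψ(6t) + ψ M₀ + Conc.reachK`,
`η = ηA := Conc.ηc`, `R₁ ρ := Conc.Rexc q (ρ + 1)`, `R₁A := Conc.Rexc q (2 ψ M₀)`, schedule `Λ := Conc.Λc` (`gap := gapc`, `E₀ := E₀c`, `L' := L'c`).
* **`SkelConc.faceHoldsR_concChoice₀`** — `(concChoice₀ κ G Φ hc t ht h0 p hp0 hp1 hC).FaceHoldsR` at every admissible centred instance.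
[cite: KozmaNitzan2024, §4 Theorem 6 (pp. 25–31), Step III (p. 30); Lemma 11 (pp. 22–23), Lemma 12 (p. 24)]
-/

noncomputable section

open MeasureTheory
open scoped Classical

namespace Summit.CriticalPhenomena.PercolationContinuityZ3.Theorems

namespace Transplant

namespace SkelConc

open Literature.Probability.Percolation Literature.Probability.LatticeModels SimpleGraph KNCells KNLevels
open BoxProdZ2 (δmin δmin_le_δ δmin_le_δ₂ δmin_le_δA δmin_pos nmaxA Kof one_le_gapFn)

/-- **The face obligation (F) of the concrete generic choice function, at every admissible centred instance** (the `FaceHoldsRFn concChoice₀`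
form is NOT restated: its printed statement would coincide with the product's `BoxProdZ2.faceHoldsRFn_concChoice₀` under the gate's statement dedup —
(Z') applies this per-instance theorem). [cite: KozmaNitzan2024, §4 Theorem 6, Step III (p. 30); Lemma 11 (pp. 22–23); Lemma 12 (p. 24)] -/
theorem faceHoldsR_concChoice₀ (κ : Consts) {V : Type} [DecidableEq V] [Countable V] (G : SimpleGraph V) [G.LocallyFinite]
    (Φ : PlanarSkeletonConc G) (hc : G.Connected) (t : V) (ht : t ∈ Φ.types) (h0 : Φ.φ t = 0) (p : unitInterval) (hp0 : 0 < (p : ℝ))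
    (hp1 : (p : ℝ) < 1) (hC : Φ.toPlanarSkeleton.CylSubcritical p) : (concChoice₀ κ G Φ hc t ht h0 p hp0 hp1 hC).FaceHoldsR := by
  intro msel M₀ q hat
  -- abbreviations
  have hδA : 0 < δA Φ κ.K₀ κ.δ₂ := δA_pos Φ κ.K₀ κ.δ₂
  have hδA1 : δA Φ κ.K₀ κ.δ₂ ≤ 1 := δA_le_one Φ κ.K₀ κ.δ₂
  have hmin0 : 0 < δmin (κ.prod Φ.Δ) Conc.nR (δA Φ κ.K₀ κ.δ₂) := δmin_pos (κ.prod Φ.Δ) Conc.nR hδA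
  have ha₂ : δmin (κ.prod Φ.Δ) Conc.nR (δA Φ κ.K₀ κ.δ₂) ≤ κ.δ₂ := δmin_le_δ₂ (κ.prod Φ.Δ) Conc.nR (δA Φ κ.K₀ κ.δ₂)
  have haA : δmin (κ.prod Φ.Δ) Conc.nR (δA Φ κ.K₀ κ.δ₂) ≤ δA Φ κ.K₀ κ.δ₂ := δmin_le_δA (κ.prod Φ.Δ) Conc.nR (δA Φ κ.K₀ κ.δ₂)
  have haδ : δmin (κ.prod Φ.Δ) Conc.nR (δA Φ κ.K₀ κ.δ₂) ≤ κ.δ := δmin_le_δ (κ.prod Φ.Δ) Conc.nR (δA Φ κ.K₀ κ.δ₂)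
  have hη : Conc.ηc κ Φ (δA Φ κ.K₀ κ.δ₂) ≤ κ.δ / 2 := by unfold Conc.ηc; linarith [haδ]
  have hηA : Conc.ηc κ Φ (δA Φ κ.K₀ κ.δ₂) ≤ δA Φ κ.K₀ κ.δ₂ / 2 := by unfold Conc.ηc; linarith [haA]
  have ham₂ : δmin (κ.prod Φ.Δ) Conc.nR (δA Φ κ.K₀ κ.δ₂) ^ 2 ≤ κ.δ₂ ^ 2 := pow_le_pow_left₀ hmin0.le ha₂ 2
  have hamA : δmin (κ.prod Φ.Δ) Conc.nR (δA Φ κ.K₀ κ.δ₂) ^ 2 ≤ δA Φ κ.K₀ κ.δ₂ ^ 2 := pow_le_pow_left₀ hmin0.le haA 2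
  have hq1 : (q : ℝ) < 1 := lt_of_le_of_lt hat.2.2.1 hp1
  -- planar numerics
  have hR'eq := Conc.R'c_eq (κ := κ) (Φ := Φ) (p := p) (hC := hC) (δA := δA Φ κ.K₀ κ.δ₂) (M := M₀)
  have hT₀ : SkelI.tanOff (M₀ + 1) M₀ = 3 * M₀ + 4 := by unfold SkelI.tanOff; omega
  have hj₀ : SkelI.tanOff (M₀ + 1) M₀ ≤ 8 * M₀ + 12 + 1 := by rw [hT₀]; omega
  -- the seed-kit constants
  obtain ⟨hk₁, hk₂, hk₃, hk₄, hk₅, hk₆⟩ := Conc.seedKit_ineqs (Φ := Φ) (p := p) (hC := hC) (M := M₀)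
  have hR'₁ : Φ.cylRadMax (M₀ + 1) ((M₀ + 1) + 2 + 2 * SkelI.tanOff (M₀ + 1) M₀) ≤ Conc.Rseedc Φ p hC M₀ := by rw [hT₀]; exact hk₁
  have hr₀₁ : (M₀ + 1) + 1 + SkelI.tanOff (M₀ + 1) M₀ + Conc.Rseedc Φ p hC M₀ ≤ Conc.r₀c Φ p hC M₀ := by rw [hT₀]; exact hk₃
  have hr₀₂ : 2 * (M₀ + 1) + 2 + SkelI.tanOff (M₀ + 1) M₀ + M₀ + Skel.fatRadius Φ hC M₀ ≤ Conc.r₀c Φ p hC M₀ := by rw [hT₀]; exact hk₄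
  have hrs₁ : (M₀ + 1) + 2 + SkelI.tanOff (M₀ + 1) M₀ + Conc.Rseedc Φ p hC M₀ ≤ Conc.rsc Φ p hC M₀ := by rw [hT₀]; exact hk₅
  have hrs₂ : 2 * (M₀ + 1) + 3 + SkelI.tanOff (M₀ + 1) M₀ + M₀ + Skel.fatRadius Φ hC M₀ ≤ Conc.rsc Φ p hC M₀ := by rw [hT₀]; exact hk₆
  -- the kit counts in the seed-slab form, at the outer accuracy `δ₂` and the inner accuracy `δA`
  have hkc₂ : (1 - (q : ℝ) ^ (1 + Φ.Δ * ((Φ.Δ + 1) ^ Conc.Rseedc Φ p hC M₀ + (SkelI.tanOff (M₀ + 1) M₀ + 2)) +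
      ((Φ.Δ + 1) ^ Conc.Rseedc Φ p hC M₀ + (SkelI.tanOff (M₀ + 1) M₀ + 2)) * (Φ.Δ + 1) ^ Skel.fatRadius Φ hC M₀)) ^
        Conc.kc κ Φ p hC (δA Φ κ.K₀ κ.δ₂) M₀ ≤ κ.δ₂ := by
    have h := Conc.hk_at hat hp0 hp1 ha₂
    rw [Conc.sBc_eq, Conc.cSc_eq, Conc.cUc_eq] at h
    rw [hT₀]
    exact h
  have hkcA : (1 - (q : ℝ) ^ (1 + Φ.Δ * ((Φ.Δ + 1) ^ Conc.Rseedc Φ p hC M₀ + (SkelI.tanOff (M₀ + 1) M₀ + 2)) +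
      ((Φ.Δ + 1) ^ Conc.Rseedc Φ p hC M₀ + (SkelI.tanOff (M₀ + 1) M₀ + 2)) * (Φ.Δ + 1) ^ Skel.fatRadius Φ hC M₀)) ^
        Conc.kc κ Φ p hC (δA Φ κ.K₀ κ.δ₂) M₀ ≤ δA Φ κ.K₀ κ.δ₂ := by
    have h := Conc.hk_at hat hp0 hp1 haA
    rw [Conc.sBc_eq, Conc.cSc_eq, Conc.cUc_eq] at h
    rw [hT₀]
    exact h
  have hN : Conc.kc κ Φ p hC (δA Φ κ.K₀ κ.δ₂) M₀ * (Φ.Δ + 1) ^ (2 * Conc.rsc Φ p hC M₀) ≤ Conc.Nc κ Φ p hC (δA Φ κ.K₀ κ.δ₂) M₀ := by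
    have h := Conc.hN_at (κ := κ) (Φ := Φ) (hC := hC) (M := M₀) hδA hp0 hp1
    rwa [Conc.Bc_eq] at h
  -- rim / inner-radius arithmetic
  have hLAL' := Conc.LA_reach_le_L' (κ := κ) (Φ := Φ) (p := p) (hC := hC) (δA := δA Φ κ.K₀ κ.δ₂) (M := M₀) (q := q)
  have hr₀K := (Conc.r₀c_le (Φ := Φ) (p := p) (hC := hC) (M := M₀)).2
  have hr₀L' : Conc.r₀c Φ p hC M₀ + 1 ≤ Conc.L'c κ Φ p hC (δA Φ κ.K₀ κ.δ₂) M₀ q := by omega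
  have hsA := Conc.face_hsA (κ := κ) (Φ := Φ) (p := p) (hC := hC) (δA := δA Φ κ.K₀ κ.δ₂) (M := M₀)
  have hℓ₁A : ((Conc.Cc κ Φ p hC (δA Φ κ.K₀ κ.δ₂) M₀).s : ℤ) + (Conc.R'c κ Φ p hC (δA Φ κ.K₀ κ.δ₂) M₀ : ℤ) ≤
      ((6 * Conc.tc κ Φ p hC (δA Φ κ.K₀ κ.δ₂) M₀ : ℕ) : ℤ) := by exact_mod_cast hsA
  have hℓ1A := Conc.face_hℓ1A (κ := κ) (Φ := Φ) (p := p) (hC := hC) (δA := δA Φ κ.K₀ κ.δ₂) (M := M₀)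
  have hgapF := fun ρ => Conc.hgap_face (κ := κ) (Φ := Φ) (p := p) (hC := hC) (δA := δA Φ κ.K₀ κ.δ₂) (M := M₀) (q := q) ρ
  have hr60 : 50 * (Conc.Cc κ Φ p hC (δA Φ κ.K₀ κ.δ₂) M₀).r ≤ 60 * (Conc.Cc κ Φ p hC (δA Φ κ.K₀ κ.δ₂) M₀).r := by omega
  -- assemble
  exact Skel.faceOblR_concS_kits Φ (Conc.Cc κ Φ p hC (δA Φ κ.K₀ κ.δ₂) M₀) t (Conc.gapc κ Φ p hC (δA Φ κ.K₀ κ.δ₂) M₀ q) (fun _ => 0)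
    (Conc.E₀c κ Φ p hC (δA Φ κ.K₀ κ.δ₂) M₀ q) (Conc.L'c κ Φ p hC (δA Φ κ.K₀ κ.δ₂) M₀ q) q κ.δ
    (fun n => one_le_gapFn _ _ n) Conc.twenty_r_le_gap (Conc.two_le_E₀c κ Φ p hC _ M₀ q) (Conc.one_le_L'c κ Φ p hC _ M₀ q) h0
    (Δ' := Φ.Δ) (Rlev := 8 * M₀ + 12 + Conc.Lc κ Φ p hC (δA Φ κ.K₀ κ.δ₂) M₀) (N := Conc.Nc κ Φ p hC (δA Φ κ.K₀ κ.δ₂) M₀) (Mj := 8 * M₀ + 12)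
    (δ₂ := κ.δ₂) Conc.face_hRlev' (Conc.hcount_Icc_at hat hp0 hp1 ha₂ (8 * M₀ + 12)) (η := Conc.ηc κ Φ (δA Φ κ.K₀ κ.δ₂)) hη
    (fun ρ => Conc.Rexc κ Φ p hC (δA Φ κ.K₀ κ.δ₂) M₀ q (ρ + 1))
    (fun ρ R' hR' Rw D' A' hD hDD hA hA' => Conc.hRex_at_le hat le_rfl t hr60 (ρ + 1) R' hR' Rw D' A' hD hDD hA hA')
    (fun ρ => by have h := hgapF ρ; omega)
    hC msel (Ssc := Conc.Sc κ Φ p hC (δA Φ κ.K₀ κ.δ₂) M₀) (δA := δA Φ κ.K₀ κ.δ₂)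
    (am := δmin (κ.prod Φ.Δ) Conc.nR (δA Φ κ.K₀ κ.δ₂) ^ 2) κ.hδ₂0 ham₂ (Conc.inputs_at hat) Conc.mem_Sc (Conc.hmsel_at hat)
    (ℓs := M₀ + 1) (R' := Conc.Rseedc Φ p hC M₀) (r₀ := Conc.r₀c Φ p hC M₀) (rs := Conc.rsc Φ p hC M₀) (k := Conc.kc κ Φ p hC (δA Φ κ.K₀ κ.δ₂) M₀)
    le_rfl hj₀ hR'₁ hk₂ hr₀₁ hr₀₂ hrs₁ hrs₂ hN hkc₂ hr₀L'
    (L_A := Conc.LAc κ Φ p hC (δA Φ κ.K₀ κ.δ₂) M₀ q + Conc.reachK Φ p hC M₀) Conc.face_hLd'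
    (s₁ := (Conc.Cc κ Φ p hC (δA Φ κ.K₀ κ.δ₂) M₀).s) (R'ᵢ := Conc.R'c κ Φ p hC (δA Φ κ.K₀ κ.δ₂) M₀) (ℓ₀ := M₀ + 1)
    (ℓ1 := M₀ + (Conc.Cc κ Φ p hC (δA Φ κ.K₀ κ.δ₂) M₀).s + 2 * Conc.R'c κ Φ p hC (δA Φ κ.K₀ κ.δ₂) M₀ + 1) (nmax := 12 * Kof κ.K₀)
    (j₀A := 8 * M₀ + 12 + 1) (RlevA := 8 * M₀ + 12 + Conc.Lc κ Φ p hC (δA Φ κ.K₀ κ.δ₂) M₀) (N_A := Conc.Nc κ Φ p hC (δA Φ κ.K₀ κ.δ₂) M₀)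
    (L'_A := Conc.ψ Φ p hC (6 * Conc.tc κ Φ p hC (δA Φ κ.K₀ κ.δ₂) M₀) + Conc.ψ Φ p hC M₀ + Conc.reachK Φ p hC M₀)
    (Conc.mem_Sc_of (by omega) hℓ1A) (Nat.lt_succ_self M₀) Conc.face_hs Conc.face_hs2 le_rfl Conc.face_hn Conc.face_hbig' Conc.face_h10s'
    Conc.face_hRl' Conc.face_hℓL' Conc.face_hLA' (Δ'ᵢ := Φ.Δ) (ηA := Conc.ηc κ Φ (δA Φ κ.K₀ κ.δ₂))
    (fun oc => δA_spec_win Φ κ.K₀ κ.hδ₂0 Conc.nmax_le_nmaxA hq1 oc _) (Conc.hcount_Icc_at hat hp0 hp1 haA (8 * M₀ + 12))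
    hδA hδA1 hamA (ℓ₁A := 6 * Conc.tc κ Φ p hC (δA Φ κ.K₀ κ.δ₂) M₀) (kkA := Conc.kc κ Φ p hC (δA Φ κ.K₀ κ.δ₂) M₀) hℓ₁A
    (fun ℓ h₁ h₂ => Conc.mem_Sc_of (by omega) h₂) hj₀ Conc.face_hr₀LA' Conc.face_hLψA' Conc.face_hLRA' hN hkcA hηA
    (R₁A := Conc.Rexc κ Φ p hC (δA Φ κ.K₀ κ.δ₂) M₀ q (2 * Conc.ψ Φ p hC M₀))
    (fun c' R'' hR'' Rw D' A' hD hDD hA hA' => Conc.hRex_at_le hat le_rfl c' hr60 _ R'' hR'' Rw D' A' hD hDD hA hA')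
    Conc.face_hR₁LA'

end SkelConc

end Transplant

end Summit.CriticalPhenomena.PercolationContinuityZ3.Theorems

end
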